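import Summits.BirchSwinnertonDyer.BirchSwinnertonDyer.Theorems.SmallImageMuTransferMuTransferX9KolyvaginCocycleMeetingPoint
import Summits.BirchSwinnertonDyer.BirchSwinnertonDyer.Theorems.SmallImageMuTransferMuTransferX9LocalQTermStepFour
import Summits.BirchSwinnertonDyer.BirchSwinnertonDyer.Theorems.SmallImageMuTransferMuTransferX9StepsTwoFourPairTransport
import Summits.BirchSwinnertonDyer.BirchSwinnertonDyer.Theorems.SmallImageMuTransferMuTransferX9StepTwoLocal
import Summits.BirchSwinnertonDyer.BirchSwinnertonDyer.Theorems.SmallImageMuTransferMuTransferX9TorsionUnramifiedOutside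
import Summits.BirchSwinnertonDyer.BirchSwinnertonDyer.Theorems.SmallImageMuTransferMuTransferX9TameGeneratorSeams
import Summits.BirchSwinnertonDyer.BirchSwinnertonDyer.Theorems.SmallImageMuTransferMuTransferX9SplitPrimeCongruence
import Summits.BirchSwinnertonDyer.BirchSwinnertonDyer.Theorems.SmallImageMuTransferMuTransferX9StepFourCocycleSeams
import Summits.BirchSwinnertonDyer.BirchSwinnertonDyer.Theorems.SmallImageMuTransferMuTransferX9LocalExponentBadPrimes
import Literature.NumberTheory.GaloisRepresentations.ModPCyclotomicCharacterInertiaSurjective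
import Literature.NumberTheory.GaloisRepresentations.LocalDualityDescent
import Literature.NumberTheory.GaloisRepresentations.AbsGaloisGroupCompact
import Literature.NumberTheory.EllipticCurves.CMTorsionIrreducibleOrdinaryProofs
import Literature.NumberTheory.EllipticCurves.WeilPairingTateDual
import Literature.NumberTheory.EllipticCurves.Kato2004.EulerSystemClasses
import Literature.NumberTheory.EllipticCurves.Kato2004.IwasawaH1ReductionTower
import Literature.NumberTheory.GaloisCohomology.PoitouTate
import HarnessLib

/-!
# K6 crux `MuTransferX9` (stmt-BirchSwinnertonDyer-19276), skeleton v6: the ASSEMBLY of the registered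
# stub `stub_stepsTwoFourOdd` from ONE hypothesis `hKoly` — the Kolyvagin package at the tame prime `q`
# (= the landed meeting point with value, x10 p469014, in the stub's currency) — composed with koly's
# `hQ`-free STEP 4 (p457656) and x9's one-Frobenius pair transport (p455870)

Cell `bsd-smallim`, seat `bsd-smallim-k6-lur-b` (gen 0; assembler per plan g11 RULING l.324).  HONEST FRAMING:
theorems only (no definition, no named fact, no `sorry`); nothing is asserted about any curve and nothing
is booked.  Helper toward the registered stub `stub_stepsTwoFourOdd` of skeleton v6 (sha16 a90a661b046bb403,
the stub text is byte-identical in v6b/v6c) of crux 19276; closes nothing by itself: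
`StepsTwoFour.stub_stepsTwoFourOdd_of (hKoly) : <stub_stepsTwoFourOdd VERBATIM>`.

## The hypothesis `hKoly` (frozen text: HOME/lurb/STEPS24-hKoly.lean.txt)

For the stub's data (its own binders up to `IsEulerSystemClass … s` VERBATIM), the PRODUCER's finite
exceptional set `S₀`, the stub's `a κ' hκ' n e' he' Φ hΦ`, a place `q ∉ S₀` (instance binders `[NeZero ℓ]
[Fact ℓ.Prime] [NeZero (ℓ : ℚ_q)] [N.Normal] [Fintype (Γ_ℚ ⧸ N)]`, `ℓ = primesEquiv q`,
`N = Gal(ℚ̄/ℚ(μ_ℓ))`, supplied HERE) and the stub's `E`-split depth-`n` Frobenius data `𝔓 Fr hFr hρ hFrn hFrn'`: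
(I0) the Euler-system tower class `(I.redTower s)_J`, `J = 2e'+2`, is unramified at `q`; and the KOLYVAGIN
PACKAGE — a global cocycle `c` of `𝒯_J(E, κ)` (the Kolyvagin class `κ_q`), `τq ∈ I_{ℚ_q}` whose mod-`ℓ`
cyclotomic character generates, the clauses `hx` (unramified at `w ≠ q`, `w ∤ p`, `E[p]` unramified at `w`)
and `loc_q [c] ∈ H¹_tr` (x10 p469014's output VERBATIM), a local arithmetic Frobenius `r`, and the VALUE
identity `c (res τq) = U(S)·S^{e'+1}·S^a·Φ(res r)` with `p ∤ U(0)` (x10 l.330 / k6-g3 g2 l.332 shape).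

## The assembly (everything else is landed)

* the exceptional set: `S₀(hKoly) ∪` x9 p455730's set (off it `v ∤ p`, good reduction, `E[p]` unramified);
* the Weil pairing of the stub ⟹ koly's `e, he, hnd, hsurj, ι, hι, h1` (`weilPairingHom`, x10
  `weilPairingHom_torsionGaloisModule_smul`, non-degeneracy + counting `#Hom(E[p], μ_p) ≤ #E[p]`,
  `muEquivZMod`);
* the fact `poitouTate_sum_localTatePairing_eq_zero ℚ` ⟹ `inv, hperf, hPT`;
* at `q`: `p ∣ N(q) − 1` (x9 `SplitPrime.dvd_absNorm_sub_one_of_isArithFrobAt_of_galoisRepTorsion_eq_one`),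
  `χ̄_{N q}` onto on `I_{ℚ_q}` (`Rat.exists_mem_absInertia_adicCompletion_modPCyclotomicCharacterZMod_eq_of_absNorm_eq`),
  `E`-splitness and depth of `res r` (x9 `isSplit_and_depth_absGaloisRestrict_of_isArithFrobAt_rat`), the
  `primesEquiv`/`absNorm` currency seams (x9 p469046 `TameSeams`);
* koly p457656 `LocalSplitPrime.convCoeff_eq_zero_of_transverse_of_unramified` with `c`, `t₀ := τq`, `Fr := r`,
  `S := S₁`: `C_i(c(res τq), Ψc(res r)) = 0` for `i + ε < J`; the value identity rewrites this as the pair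
  statement at `(Φ'(res r), Ψc(res r))`, `Φ' := S^a ∘ Φ` (a cocycle of `(I.redTower s)_J`, unramified at `q` by
  (I0));
* x9 p455870 `exists_forall_convCoeff_aeval_eq_zero_of_isAbsArithFrob` carries it to the stub's `(𝔓, Fr)`.

PARTITION (D-0054): X9 (A4) × p ∈ {5,7} (+ X10b∧¬Surj at 3) — the assembly scaffold of `stub_stepsTwoFourOdd`;
closes none (the stub closes when `hKoly` is discharged: x10 g39 / k6-g3 g2 / koly g9, then k6-c2 g4's plug).

References: HOME/koly/MU-TRANSFER-PROOF.md §§2–5; B. Mazur, K. Rubin, Mem. AMS 799 (2004) Prop. 1.3.2, §4.4,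
§5.3 [MazurRubin2004]; K. Rubin, *Euler Systems* (2000) §4.4–4.5 [Rubin2000]; J. S. Milne, *Arithmetic
Duality Theorems* (2006) I Thm. 4.10 [MilneADT2006]; K. Kato, Astérisque 295 (2004) §13 [Kato2004Asterisque].
-/

set_option linter.dupNamespace false
set_option autoImplicit false

noncomputable section

open scoped NumberField ContRepresentation
open CategoryTheory Function Finset Polynomial
open Field IsDedekindDomain NumberField
open Literature.NumberTheory.GaloisRepresentations
open Literature.NumberTheory.GaloisRepresentations.IsNonarchimedeanLocalField
open Literature.NumberTheory.GaloisCohomology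
open Literature.NumberTheory.EllipticCurves
open Literature.NumberTheory.EllipticCurves.Kato2004
open Literature.NumberTheory.EllipticCurves.Kato2004.EulerSystemValues
open Rat.HeightOneSpectrum
open Summit.BirchSwinnertonDyer.Rank1Residual.GaloisImage

namespace Summit.BirchSwinnertonDyer.BirchSwinnertonDyer.Rank1Residual.StepsTwoFour

/-! ## §1 The Weil pairing of the stub in koly's currency -/

section Weil

variable (W : WeierstrassCurve ℚ) (p : ℕ) [Fact p.Prime]
  (eW : WeierstrassCurve.geomTorsion W (p : ℤ) → WeierstrassCurve.geomTorsion W (p : ℤ) → AlgebraicClosure ℚ)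
  (hμ : ∀ S T, eW S T ^ p = 1) (hadd₁ : ∀ S₁ S₂ T, eW (S₁ + S₂) T = eW S₁ T * eW S₂ T)
  (hadd₂ : ∀ S T₁ T₂, eW S (T₁ + T₂) = eW S T₁ * eW S T₂)

/-- Non-degeneracy of the additive Weil pairing hom from the stub's clause
`∀ T, (∀ S, eW S T = 1) → T = 0`. [cite: SilvermanAEC2009, Prop. III.8.1] -/
theorem weilPairingHom_right_nondegenerate (hnd : ∀ T, (∀ S, eW S T = 1) → T = 0)
    (b : WeierstrassCurve.geomTorsion W (p : ℤ))
    (hb : ∀ a, weilPairingHom W p eW hμ hadd₁ hadd₂ a b = 0) : b = 0 := by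
  refine hnd b fun a => ?_
  have h := hb a
  rw [muCarrier_eq_iff, coe_weilPairingHom] at h
  exact h

/-- **Perfectness on the right**: every additive character `χ : E[p] → μ_p` is `e(·, b)` for some `b`
(non-degeneracy + counting: `#Hom(E[p], μ_p) ≤ #E[p]`). [cite: SilvermanAEC2009, Prop. III.8.1] -/
theorem weilPairingHom_right_surjective [W.IsElliptic] (hnd : ∀ T, (∀ S, eW S T = 1) → T = 0)
    (χ : WeierstrassCurve.geomTorsion W (p : ℤ) →+ DiscreteGaloisModule.MuCarrier ℚ p) :
    ∃ b, ∀ a, weilPairingHom W p eW hμ hadd₁ hadd₂ a b = χ a := by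
  haveI : NeZero p := ⟨(Fact.out : p.Prime).ne_zero⟩
  haveI : Finite (WeierstrassCurve.geomTorsion W (p : ℤ)) := finite_geomTorsion_of_neZero W p
  -- the injective map `b ↦ e(·, b)`
  let F : WeierstrassCurve.geomTorsion W (p : ℤ) →
      (WeierstrassCurve.geomTorsion W (p : ℤ) →+ DiscreteGaloisModule.MuCarrier ℚ p) :=
    fun b => (weilPairingHom W p eW hμ hadd₁ hadd₂).flip b
  have hF : Function.Injective F := fun b b' hbb' => by
    rw [← sub_eq_zero]
    refine weilPairingHom_right_nondegenerate W p eW hμ hadd₁ hadd₂ hnd _ fun a => ?_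
    have h := DFunLike.congr_fun hbb' a
    simp only [F, AddMonoidHom.flip_apply] at h
    rw [map_sub, h, sub_self]
  -- counting: `#Hom(M, μ_p) ≤ #Hom(M, ℤ/p) ≤ #M`
  let ι : DiscreteGaloisModule.MuCarrier ℚ p →+ ZMod p := (muEquivZMod ℚ p).toAddMonoidHom
  have hι : Function.Injective ι := (muEquivZMod ℚ p).injective
  haveI : Finite (WeierstrassCurve.geomTorsion W (p : ℤ) →+ ZMod p) :=
    Finite.of_injective (fun f : WeierstrassCurve.geomTorsion W (p : ℤ) →+ ZMod p =>
      (f : WeierstrassCurve.geomTorsion W (p : ℤ) → ZMod p)) DFunLike.coe_injective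
  have hcomp : Function.Injective
      (fun f : WeierstrassCurve.geomTorsion W (p : ℤ) →+ DiscreteGaloisModule.MuCarrier ℚ p => ι.comp f) :=
    fun f g hfg => AddMonoidHom.ext fun a => hι (DFunLike.congr_fun hfg a)
  haveI : Finite (WeierstrassCurve.geomTorsion W (p : ℤ) →+ DiscreteGaloisModule.MuCarrier ℚ p) :=
    Finite.of_injective _ hcomp
  have hcard : Nat.card (WeierstrassCurve.geomTorsion W (p : ℤ) →+ DiscreteGaloisModule.MuCarrier ℚ p) ≤
      Nat.card (WeierstrassCurve.geomTorsion W (p : ℤ)) :=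
    (Nat.card_le_card_of_injective _ hcomp).trans
      (LocalSplitPrime.natCard_addMonoidHom_zmod_le (WeierstrassCurve.geomTorsion W (p : ℤ)) p)
  obtain ⟨b, hb⟩ := (hF.bijective_of_nat_card_le hcard).2 χ
  exact ⟨b, fun a => by rw [← hb]; rfl⟩

/-- **An injective trivialisation `ι : μ_p ↪ ℤ/p` with `ι (e v₀ w₀) = 1`** for some torsion points
`v₀, w₀` (the pairing is non-zero since `E[p] ≠ 0` and it is non-degenerate).
[cite: SilvermanAEC2009, Prop. III.8.1] -/
theorem exists_iota_weilPairingHom_eq_one [W.IsElliptic] (hnd : ∀ T, (∀ S, eW S T = 1) → T = 0) :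
    ∃ (ι : DiscreteGaloisModule.MuCarrier ℚ p →+ ZMod p) (v₀ w₀ : WeierstrassCurve.geomTorsion W (p : ℤ)),
      Function.Injective ι ∧ ι (weilPairingHom W p eW hμ hadd₁ hadd₂ v₀ w₀) = 1 := by
  have hp : p.Prime := Fact.out
  haveI : NeZero p := ⟨hp.ne_zero⟩
  haveI : Finite (WeierstrassCurve.geomTorsion W (p : ℤ)) := finite_geomTorsion_of_neZero W p
  -- a non-zero torsion point
  have hcard : Nat.card (WeierstrassCurve.geomTorsion W (p : ℤ)) = p ^ 2 :=
    W.natCard_geomTorsion_natCast hp.ne_zero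
  have hnt : Nontrivial (WeierstrassCurve.geomTorsion W (p : ℤ)) := by
    rw [← Finite.one_lt_card_iff_nontrivial, hcard]
    exact Nat.one_lt_pow two_ne_zero hp.one_lt
  obtain ⟨w₀, hw₀⟩ := exists_ne (0 : WeierstrassCurve.geomTorsion W (p : ℤ))
  -- some `v₀` pairs non-trivially with it
  have hex : ∃ v₀, weilPairingHom W p eW hμ hadd₁ hadd₂ v₀ w₀ ≠ 0 := by
    by_contra h
    exact hw₀ (weilPairingHom_right_nondegenerate W p eW hμ hadd₁ hadd₂ hnd w₀ (by simpa using h))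
  obtain ⟨v₀, hv₀⟩ := hex
  have hc0 : muEquivZMod ℚ p (weilPairingHom W p eW hμ hadd₁ hadd₂ v₀ w₀) ≠ 0 :=
    fun h0 => hv₀ ((muEquivZMod ℚ p).map_eq_zero_iff.mp h0)
  refine ⟨(AddMonoidHom.mulLeft (muEquivZMod ℚ p (weilPairingHom W p eW hμ hadd₁ hadd₂ v₀ w₀))⁻¹).comp
    (muEquivZMod ℚ p).toAddMonoidHom, v₀, w₀, fun x y hxy => ?_, ?_⟩
  · exact (muEquivZMod ℚ p).injective (mul_left_cancel₀ (inv_ne_zero hc0) hxy)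
  · exact inv_mul_cancel₀ hc0

end Weil

/-! ## §2 The assembly -/

-- heartbeat head-room (lur-b g2 probe 2026-08-27: 145k < usage ≤ 160k of the default 200k): own budget line
set_option maxHeartbeats 400000 in
/-- **The registered stub `stub_stepsTwoFourOdd` of skeleton v6 (crux 19276) from the Kolyvagin package
`hKoly`** (module docstring).  MU-TRANSFER-PROOF §5 STEPS 2–4: Chebotarev prime `q`, Kolyvagin class `κ_q`
(hypothesis), Poitou–Tate + Lemma 1 (iii) (koly p457656), pair transport to the stub's Frobenius (x9 p455870).
[cite: MazurRubin2004, Prop. 1.3.2, §4.4 and §5.3] [cite: Rubin2000, Thm. 4.5.1 and §4.4]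
[cite: MilneADT2006, Ch. I, Thm. 4.10(b)] -/
theorem stub_stepsTwoFourOdd_of
    (hKoly : ∀ (W : WeierstrassCurve ℚ) [W.IsElliptic] [W.IsGloballyMinimal] (p : ℕ) [Fact p.Prime]
      [ContinuousSMul ℤ_[p] (W.tateModule p)] [Module.Free ℤ_[p] (W.tateModule p)]
      [Module.Finite ℤ_[p] (W.tateModule p)] (κ : ZpExtension ℚ p) (γ : absoluteGaloisGroup ℚ)
      (I : IwasawaH1Data W p κ γ), p ≠ 2 → W.HasIrreducibleModPGaloisRep p → ¬ W.HasSurjectiveModNGaloisRep p →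
      κ.IsCyclotomic → κ.IsTopGenerator γ → ∀ (s : I.H), IsEulerSystemClass W p κ γ I s →
      ∃ (S₀ : Set (HeightOneSpectrum (𝓞 ℚ))), S₀.Finite ∧
      ∀ (a : ℕ) (κ' : κ.twistTower (W.torsionGaloisModule (p : ℤ))
          (fun P : WeierstrassCurve.geomTorsion W (p : ℤ) => AddSubgroup.torsionBy.nsmul P)),
        (κ.towerShift (W.torsionGaloisModule (p : ℤ))
          (fun P : WeierstrassCurve.geomTorsion W (p : ℤ) => AddSubgroup.torsionBy.nsmul P))^[a] κ' = I.redTower s →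
      ∀ (n e' : ℕ), e' + 1 = p ^ n →
      ∀ (Φ : contOneCocycles (W.modPTwist p κ (2 * e' + 1 + 1)).toTopRep),
        oneCocycleClass (W.modPTwist p κ (2 * e' + 1 + 1)).toTopRep Φ = κ'.1 (2 * e' + 1 + 1) →
      ∀ (q : HeightOneSpectrum (𝓞 ℚ)), q ∉ S₀ →
      ∀ [NeZero ((primesEquiv q : Nat.Primes) : ℕ)] [Fact (((primesEquiv q : Nat.Primes) : ℕ)).Prime]
        [NeZero ((((primesEquiv q : Nat.Primes) : ℕ) : ℕ) : q.adicCompletion ℚ)]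
        [(rootsOfUnityFixer ℚ ((primesEquiv q : Nat.Primes) : ℕ)).Normal]
        [Fintype (absoluteGaloisGroup ℚ ⧸ rootsOfUnityFixer ℚ ((primesEquiv q : Nat.Primes) : ℕ))],
      ∀ 𝔓 ∈ q.primesAbove, ∀ (Fr : absoluteGaloisGroup ℚ), IsArithFrobAt (𝓞 ℚ) Fr 𝔓 →
        WeierstrassCurve.galoisRepTorsion W p Fr = 1 → Fr ∈ κ.layerSubgroup n → Fr ∉ κ.layerSubgroup (n + 1) →
      -- (I0) the Euler-system tower class at level `J = 2e'+2` is unramified at `q`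
      galoisCohomology.localization (W.modPTwist p κ (2 * e' + 1 + 1)) (Sum.inr q) 1
          ((I.redTower s).1 (2 * e' + 1 + 1)) ∈
        DiscreteGaloisModule.unramifiedSubgroup (GaloisRep.toLocal q (W.modPTwist p κ (2 * e' + 1 + 1))) 1 ∧
      -- the KOLYVAGIN PACKAGE at `q`: a global cocycle `c` (the Kolyvagin class `κ_q` at level `J`), a tame
      -- generator `τq ∈ I_{ℚ_q}` read through `χ̄_ℓ`, a local arithmetic Frobenius `r`, and the VALUE identity
      ∃ (c : contOneCocycles (W.modPTwist p κ (2 * e' + 1 + 1)).toTopRep)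
        (τq r : absoluteGaloisGroup (q.adicCompletion ℚ)),
        τq ∈ absInertia (q.adicCompletion ℚ) ∧
        (∀ u : (ZMod ((primesEquiv q : Nat.Primes) : ℕ))ˣ,
          u ∈ Subgroup.zpowers (modPCyclotomicCharacterZMod (q.adicCompletion ℚ)
            ((primesEquiv q : Nat.Primes) : ℕ) τq)) ∧
        (∀ w : HeightOneSpectrum (𝓞 ℚ), w ≠ q → ((p : ℕ) : 𝓞 ℚ) ∉ w.asIdeal →
          GaloisRep.IsUnramifiedAt w (W.torsionGaloisModule (p : ℤ)) →
          galoisCohomology.localization (W.modPTwist p κ (2 * e' + 1 + 1)) (Sum.inr w) 1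
              (oneCocycleClass (W.modPTwist p κ (2 * e' + 1 + 1)).toTopRep c) ∈
            DiscreteGaloisModule.unramifiedSubgroup
              (GaloisRep.toLocal w (W.modPTwist p κ (2 * e' + 1 + 1))) 1) ∧
        galoisCohomology.localization (W.modPTwist p κ (2 * e' + 1 + 1)) (Sum.inr q) 1
            (oneCocycleClass (W.modPTwist p κ (2 * e' + 1 + 1)).toTopRep c) ∈
          DiscreteGaloisModule.transverseSubgroup (GaloisRep.toLocal q (W.modPTwist p κ (2 * e' + 1 + 1)))
            (CyclotomicField ((primesEquiv q : Nat.Primes) : ℕ) (q.adicCompletion ℚ)) ∧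
        IsAbsArithFrob r ∧
        ∃ U : Polynomial ℤ, ¬ ((p : ℤ) ∣ U.coeff 0) ∧
          c.1 (absGaloisRestrict ℚ (q.adicCompletion ℚ) τq) =
            Polynomial.aeval (shiftEnd (WeierstrassCurve.geomTorsion W (p : ℤ)) (2 * e' + 1 + 1)) U
              ((shiftEnd (WeierstrassCurve.geomTorsion W (p : ℤ)) (2 * e' + 1 + 1) ^ (e' + 1))
                ((shiftEnd (WeierstrassCurve.geomTorsion W (p : ℤ)) (2 * e' + 1 + 1) ^ a)
                  (Φ.1 (absGaloisRestrict ℚ (q.adicCompletion ℚ) r))))) :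
    ∀ (W : WeierstrassCurve ℚ) [W.IsElliptic] [W.IsGloballyMinimal] (p : ℕ) [Fact p.Prime] [ContinuousSMul ℤ_[p] (W.tateModule p)] [Module.Free ℤ_[p] (W.tateModule p)] [Module.Finite ℤ_[p] (W.tateModule p)] (κ : ZpExtension ℚ p) (γ : absoluteGaloisGroup ℚ) (I : IwasawaH1Data W p κ γ), p ≠ 2 → W.HasIrreducibleModPGaloisRep p → ¬ W.HasSurjectiveModNGaloisRep p → κ.IsCyclotomic → κ.IsTopGenerator γ → poitouTate_sum_localTatePairing_eq_zero ℚ → ∀ (s : I.H), IsEulerSystemClass W p κ γ I s → ∃ (S₀ : Set (HeightOneSpectrum (𝓞 ℚ))), S₀.Finite ∧ ∀ (a : ℕ) (κ' : κ.twistTower (W.torsionGaloisModule (p : ℤ)) (fun P : WeierstrassCurve.geomTorsion W (p : ℤ) => AddSubgroup.torsionBy.nsmul P)), (κ.towerShift (W.torsionGaloisModule (p : ℤ)) (fun P : WeierstrassCurve.geomTorsion W (p : ℤ) => AddSubgroup.torsionBy.nsmul P))^[a] κ' = I.redTower s → ∀ (n e' : ℕ), e' + 1 = p ^ n → ∀ (Φ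 : contOneCocycles (W.modPTwist p κ (2 * e' + 1 + 1)).toTopRep), oneCocycleClass (W.modPTwist p κ (2 * e' + 1 + 1)).toTopRep Φ = κ'.1 (2 * e' + 1 + 1) → ∀ (ε : ℕ) (S₁ : Set (HeightOneSpectrum (𝓞 ℚ))) (Ψ : galoisCohomology (W.modPTwist p κ.invTwist (2 * e' + 1 + 1)) 1) (Ψc : contOneCocycles (W.modPTwist p κ.invTwist (2 * e' + 1 + 1)).toTopRep), S₀ ⊆ S₁ → oneCocycleClass (W.modPTwist p κ.invTwist (2 * e' + 1 + 1)).toTopRep Ψc = Ψ → (∀ v : HeightOneSpectrum (𝓞 ℚ), v ∉ S₁ → galoisCohomology.localization (W.modPTwist p κ.invTwist (2 * e' + 1 + 1)) (Sum.inr v) 1 Ψ ∈ DiscreteGaloisModule.unramifiedSubgroup (GaloisRep.toLocal v (W.modPTwist p κ.invTwist (2 * e' + 1 + 1))) 1) → (∀ v : HeightOneSpectrum (𝓞 ℚ), v ∈ S₁ → galoisCohomology.localization (W.modPTwist p κ.invTwist (2 * e' + 1 + 1)) (Sum.inr v) 1 ((κ.invTwist.shiftH1 (W.torsionGaloisModule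 (p : ℤ)) (fun P : WeierstrassCurve.geomTorsion W (p : ℤ) => AddSubgroup.torsionBy.nsmul P) (2 * e' + 1 + 1))^[ε] Ψ) = 0) → ∀ (eW : WeierstrassCurve.geomTorsion W (p : ℤ) → WeierstrassCurve.geomTorsion W (p : ℤ) → AlgebraicClosure ℚ) (hμ : ∀ S T, eW S T ^ p = 1) (hadd₁ : ∀ S₁' S₂' T, eW (S₁' + S₂') T = eW S₁' T * eW S₂' T) (hadd₂ : ∀ S T₁ T₂, eW S (T₁ + T₂) = eW S T₁ * eW S T₂), (∀ T, eW T T = 1) → (∀ T, (∀ S, eW S T = 1) → T = 0) → (∀ (σ : absoluteGaloisGroup ℚ) (S T : WeierstrassCurve.geomTorsion W (p : ℤ)), σ • eW S T = eW (σ • S) (σ • T)) → ∀ (q : HeightOneSpectrum (𝓞 ℚ)), q ∉ S₁ → ∀ 𝔓 ∈ q.primesAbove, ∀ (Fr : absoluteGaloisGroup ℚ), IsArithFrobAt (𝓞 ℚ) Fr 𝔓 → WeierstrassCurve.galoisRepTorsion W p Fr = 1 → Fr ∈ κ.layerSubgroup n → Fr ∉ κ.layerSubgroup (n + 1) → ∃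 U : Polynomial ℤ, ¬ ((p : ℤ) ∣ U.coeff 0) ∧ ∀ i : ℕ, i + ε < 2 * e' + 1 + 1 → convCoeff (weilPairingHom W p eW hμ hadd₁ hadd₂) (2 * e' + 1 + 1) i (Polynomial.aeval (shiftEnd (WeierstrassCurve.geomTorsion W (p : ℤ)) (2 * e' + 1 + 1)) U ((shiftEnd (WeierstrassCurve.geomTorsion W (p : ℤ)) (2 * e' + 1 + 1) ^ (e' + 1 + a)) (Φ.1 Fr))) (Ψc.1 Fr) = 0 := by
  intro W _ _ p _ _ _ _ κ γ I hp2 hirr hns hκ hγ hPTfact s hES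
  have hp : p.Prime := Fact.out
  haveI : NeZero p := ⟨hp.ne_zero⟩
  haveI : Finite (WeierstrassCurve.geomTorsion W (p : ℤ)) := finite_geomTorsion_of_neZero W p
  -- the producer's exceptional set and x9's set (off it: `v ∤ p`, good reduction, `E[p]` unramified)
  obtain ⟨S₀', hS₀'fin, hK⟩ := hKoly W p κ γ I hp2 hirr hns hκ hγ s hES
  obtain ⟨S₀'', hS₀''fin, hS₀''⟩ :=
    TorsionUnramified.exists_finite_isUnramifiedAt_torsionGaloisModule W (K := ℚ) (p := p) hp.ne_zero
  refine ⟨S₀' ∪ S₀'', hS₀'fin.union hS₀''fin, ?_⟩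
  intro a κ' hκ' n e' he' Φ hΦ ε S₁ Ψ Ψc hS hΨc hΨur hΨS eW hμ hadd₁ hadd₂ halt hnd hgal q hq 𝔓 h𝔓 Fr hFr
    hρ hFrn hFrn'
  have hq' : q ∉ S₀' := fun h => hq (hS (Or.inl h))
  have hoff : ∀ v ∉ S₁, ((p : ℕ) : 𝓞 ℚ) ∉ v.asIdeal ∧ W.HasGoodReductionAt v ∧
      GaloisRep.IsUnramifiedAt v (W.torsionGaloisModule (p : ℤ)) :=
    fun v hv => hS₀'' v fun h => hv (hS (Or.inr h))
  obtain ⟨hqp, -, hur⟩ := hoff q hq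
  -- the prime `ℓ` of `q`, instances at `q`
  haveI : NeZero ((primesEquiv q : Nat.Primes) : ℕ) := ⟨(primesEquiv q).2.ne_zero⟩
  haveI : Fact (((primesEquiv q : Nat.Primes) : ℕ)).Prime := ⟨(primesEquiv q).2⟩
  haveI : NeZero ((((primesEquiv q : Nat.Primes) : ℕ) : ℕ) : q.adicCompletion ℚ) := by
    haveI := charZero_adicCompletion q; exact NeZero.charZero
  haveI hN : (rootsOfUnityFixer ℚ ((primesEquiv q : Nat.Primes) : ℕ)).Normal :=
    KolyvaginTwist.normal_rootsOfUnityFixer _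
  haveI : CompactSpace (absoluteGaloisGroup ℚ) := absoluteGaloisGroup_compactSpace ℚ
  haveI : (rootsOfUnityFixer ℚ ((primesEquiv q : Nat.Primes) : ℕ)).FiniteIndex :=
    finiteIndex_of_isOpen_of_compactSpace _ (isOpen_rootsOfUnityFixer ℚ _)
  haveI : Fintype (absoluteGaloisGroup ℚ ⧸ rootsOfUnityFixer ℚ ((primesEquiv q : Nat.Primes) : ℕ)) :=
    Fintype.ofFinite _
  have hℓabs : Ideal.absNorm q.asIdeal = ((primesEquiv q : Nat.Primes) : ℕ) :=
    Literature.NumberTheory.LFunctions.absNorm_asIdeal_eq_primesEquiv q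
  haveI : Fact (Ideal.absNorm q.asIdeal).Prime := ⟨by rw [hℓabs]; exact (primesEquiv q).2⟩
  haveI : NeZero ((Ideal.absNorm q.asIdeal : ℕ) : q.adicCompletion ℚ) :=
    ⟨by rw [hℓabs]; exact NeZero.ne _⟩
  haveI : LocallyCompactSpace (absoluteGaloisGroup ℚ) := inferInstance
  haveI : CompactSpace (absoluteGaloisGroup (q.adicCompletion ℚ)) :=
    absoluteGaloisGroup_compactSpace (q.adicCompletion ℚ)
  haveI : LocallyCompactSpace (absoluteGaloisGroup (Place.Completion (Sum.inr q : Place ℚ))) :=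
    (inferInstance : LocallyCompactSpace (absoluteGaloisGroup (q.adicCompletion ℚ)))
  -- the Kolyvagin package at `q`
  obtain ⟨hI0, c, τq, r, hτq, hgen, hx, hcq, hr, U, hU0, hval⟩ :=
    hK a κ' hκ' n e' he' Φ hΦ q hq' 𝔓 h𝔓 Fr hFr hρ hFrn hFrn'
  -- `E`-splitness and depth of the local Frobenius `r`
  obtain ⟨hsplit, hρr, hrn, hrn'⟩ :=
    StepsTwoFourTransport.isSplit_and_depth_absGaloisRestrict_of_isArithFrobAt_rat W p κ hur hqp h𝔓 hFr hρ
      hFrn hFrn' hr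
  -- `p ∣ N(q) − 1`, `χ̄_{N q}` onto on inertia, `hgen` and `hcq` in the `absNorm` currency
  have hpl : p ∣ Ideal.absNorm q.asIdeal - 1 :=
    SplitPrime.dvd_absNorm_sub_one_of_isAbsArithFrob_of_galoisRepTorsion_eq_one W p hqp hr hρr
  have hχI : ∀ u : (ZMod (Ideal.absNorm q.asIdeal))ˣ, ∃ t ∈ absInertia (q.adicCompletion ℚ),
      modPCyclotomicCharacterZMod (q.adicCompletion ℚ) (Ideal.absNorm q.asIdeal) t = u := fun u =>
    Rat.exists_mem_absInertia_adicCompletion_modPCyclotomicCharacterZMod_eq_of_absNorm_eq q rfl u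
  have hgen' : ∀ u : (ZMod (Ideal.absNorm q.asIdeal))ˣ,
      u ∈ Subgroup.zpowers (modPCyclotomicCharacterZMod (q.adicCompletion ℚ) (Ideal.absNorm q.asIdeal) τq) := by
    have key : ∀ (m : ℕ) [Fact m.Prime] [NeZero ((m : ℕ) : q.adicCompletion ℚ)],
        m = ((primesEquiv q : Nat.Primes) : ℕ) →
        ∀ u : (ZMod m)ˣ, u ∈ Subgroup.zpowers (modPCyclotomicCharacterZMod (q.adicCompletion ℚ) m τq) := by
      intro m _ _ hm; subst hm; exact hgen
    exact key _ hℓabs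
  have hcq' := (TameSeams.mem_transverseSubgroup_cyclotomicField_absNorm_iff q _ _).2 hcq
  -- the Weil pairing datum and the Poitou–Tate invariants
  have he := StepFour.weilPairingHom_torsionGaloisModule_smul W p eW hμ hadd₁ hadd₂ hgal
  have hnd' := weilPairingHom_right_nondegenerate W p eW hμ hadd₁ hadd₂ hnd
  have hsurj := weilPairingHom_right_surjective W p eW hμ hadd₁ hadd₂ hnd
  obtain ⟨ι, v₀, w₀, hι, h1⟩ := exists_iota_weilPairingHom_eq_one W p eW hμ hadd₁ hadd₂ hnd
  obtain ⟨inv, hperf, hPT⟩ := hPTfact p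
  -- the Selmer-side clauses of `Ψ = [Ψc]`
  have hΨ : ∀ v ∉ S₁, galoisCohomology.localization (W.modPTwist p κ.invTwist (2 * e' + 1 + 1)) (Sum.inr v) 1
      (oneCocycleClass (W.modPTwist p κ.invTwist (2 * e' + 1 + 1)).toTopRep Ψc) ∈
      DiscreteGaloisModule.unramifiedSubgroup
        (GaloisRep.toLocal v (W.modPTwist p κ.invTwist (2 * e' + 1 + 1))) 1 := fun v hv => by
    rw [hΨc]; exact hΨur v hv
  have hΨS' : ∀ v ∈ S₁, galoisCohomology.localization (W.modPTwist p κ.invTwist (2 * e' + 1 + 1)) (Sum.inr v) 1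
      ((κ.invTwist.shiftH1 (W.torsionGaloisModule (p : ℤ))
        (fun P : WeierstrassCurve.geomTorsion W (p : ℤ) => AddSubgroup.torsionBy.nsmul P) (2 * e' + 1 + 1))^[ε]
        (oneCocycleClass (W.modPTwist p κ.invTwist (2 * e' + 1 + 1)).toTopRep Ψc)) = 0 := fun v hv => by
    rw [hΨc]; exact hΨS v hv
  have hxS : ∀ v ∉ S₁, v ≠ q → galoisCohomology.localization (W.modPTwist p κ (2 * e' + 1 + 1)) (Sum.inr v) 1
      (oneCocycleClass (W.modPTwist p κ (2 * e' + 1 + 1)).toTopRep c) ∈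
      DiscreteGaloisModule.unramifiedSubgroup (GaloisRep.toLocal v (W.modPTwist p κ (2 * e' + 1 + 1))) 1 :=
    fun v hv hvq => hx v hvq (hoff v hv).1 (hoff v hv).2.2
  -- depth bookkeeping: `n + 1 ≤ J`
  have hnJ : n + 1 ≤ 2 * e' + 1 + 1 := by
    have := Nat.lt_pow_self hp.one_lt (n := n); omega
  -- STEP 4 ⊕ Lemma 1 (iii) at `(c, τq, r)` (koly p457656)
  have h4 : ∀ i, i + ε < 2 * e' + 1 + 1 →
      convCoeff (weilPairingHom W p eW hμ hadd₁ hadd₂) (2 * e' + 1 + 1) i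
        (c.1 (absGaloisRestrict ℚ (q.adicCompletion ℚ) τq))
        (Ψc.1 (absGaloisRestrict ℚ (q.adicCompletion ℚ) r)) = 0 := by
    unfold WeierstrassCurve.modPTwist at c hxS hcq' Ψc hΨ hΨS' ⊢
    exact LocalSplitPrime.convCoeff_eq_zero_of_transverse_of_unramified (W.torsionGaloisModule (p : ℤ))
      (W.torsionGaloisModule (p : ℤ)) (fun P => AddSubgroup.torsionBy.nsmul P)
      (fun P => AddSubgroup.torsionBy.nsmul P) κ (2 * e' + 1 + 1) q hp2 he hnd' hsurj ι hι h1 hperf hPT S₁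
      hq (fun v hv => (hoff v hv).1) (fun v hv => (hoff v hv).2.2) hur hpl hχI hr hsplit hsplit hnJ hrn hrn'
      hτq hgen' c hxS hcq' Ψc hΨ ε hΨS'
  -- the unramified avatar `Φ' = S^a ∘ Φ` of `(I.redTower s)_J`
  set Φ' := κ.shiftPowCocycle (W.torsionGaloisModule (p : ℤ))
    (fun P : WeierstrassCurve.geomTorsion W (p : ℤ) => AddSubgroup.torsionBy.nsmul P) (2 * e' + 1 + 1) a Φ
    with hΦ'def
  have hΦ'cl : oneCocycleClass (W.modPTwist p κ (2 * e' + 1 + 1)).toTopRep Φ' =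
      (I.redTower s).1 (2 * e' + 1 + 1) := by
    change oneCocycleClass (κ.twistModP (W.torsionGaloisModule (p : ℤ))
      (fun P : WeierstrassCurve.geomTorsion W (p : ℤ) => AddSubgroup.torsionBy.nsmul P) (2 * e' + 1 + 1)).toTopRep
      (κ.shiftPowCocycle (W.torsionGaloisModule (p : ℤ))
        (fun P : WeierstrassCurve.geomTorsion W (p : ℤ) => AddSubgroup.torsionBy.nsmul P) (2 * e' + 1 + 1) a Φ) = _
    rw [← ZpExtension.shiftH1_iterate_oneCocycleClass, ← hκ', ZpExtension.towerShift_iterate_apply_coe]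
    exact congrArg _ hΦ
  have hΦ'I : ∀ i ∈ absInertia (q.adicCompletion ℚ), Φ'.1 (absGaloisRestrict ℚ (q.adicCompletion ℚ) i) = 0 :=
    fun i hi => StepFour.apply_absGaloisRestrict_eq_zero_of_localization_mem_unramified κ
      (W.torsionGaloisModule (p : ℤ)) (fun P => AddSubgroup.torsionBy.nsmul P) (2 * e' + 1 + 1) q hur hqp Φ'
      (by rw [← hΦ'cl] at hI0; exact hI0) hi
  have hΨI : ∀ i ∈ absInertia (q.adicCompletion ℚ), Ψc.1 (absGaloisRestrict ℚ (q.adicCompletion ℚ) i) = 0 :=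
    fun i hi => StepFour.apply_absGaloisRestrict_eq_zero_of_localization_mem_unramified κ.invTwist
      (W.torsionGaloisModule (p : ℤ)) (fun P => AddSubgroup.torsionBy.nsmul P) (2 * e' + 1 + 1) q hur hqp Ψc
      (hΨ q hq) hi
  -- the pair statement at the local Frobenius `r`
  have hloc : ∃ U : Polynomial ℤ, ¬ ((p : ℤ) ∣ U.coeff 0) ∧ ∀ i, i + ε < 2 * e' + 1 + 1 →
      convCoeff (weilPairingHom W p eW hμ hadd₁ hadd₂) (2 * e' + 1 + 1) i
        (Polynomial.aeval (shiftEnd (WeierstrassCurve.geomTorsion W (p : ℤ)) (2 * e' + 1 + 1)) U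
          ((shiftEnd (WeierstrassCurve.geomTorsion W (p : ℤ)) (2 * e' + 1 + 1) ^ (e' + 1))
            (Φ'.1 (absGaloisRestrict ℚ (q.adicCompletion ℚ) r))))
        (Ψc.1 (absGaloisRestrict ℚ (q.adicCompletion ℚ) r)) = 0 := by
    refine ⟨U, hU0, fun i hi => ?_⟩
    have hval' : Polynomial.aeval (shiftEnd (WeierstrassCurve.geomTorsion W (p : ℤ)) (2 * e' + 1 + 1)) U
          ((shiftEnd (WeierstrassCurve.geomTorsion W (p : ℤ)) (2 * e' + 1 + 1) ^ (e' + 1))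
            (Φ'.1 (absGaloisRestrict ℚ (q.adicCompletion ℚ) r))) =
        c.1 (absGaloisRestrict ℚ (q.adicCompletion ℚ) τq) := by
      rw [hval, hΦ'def, ZpExtension.shiftPowCocycle_apply]
    rw [hval']
    exact h4 i hi
  -- equivariance of `e` in the `•` spelling, and the transport to the stub's `(𝔓, Fr)` (x9 p455870)
  have he' : ∀ (g : absoluteGaloisGroup ℚ) (m m' : WeierstrassCurve.geomTorsion W (p : ℤ)),
      weilPairingHom W p eW hμ hadd₁ hadd₂ (g • m) (g • m') =
        DiscreteGaloisModule.mu ℚ p g (weilPairingHom W p eW hμ hadd₁ hadd₂ m m') := fun g m m' => by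
    rw [← WeierstrassCurve.torsionGaloisModule_apply_apply, ← WeierstrassCurve.torsionGaloisModule_apply_apply]
    exact he g m m'
  have hJm : 2 * e' + 1 + 1 ≤ (e' + 1) + p ^ n := by omega
  obtain ⟨U', hU'0, hU'⟩ :=
    StepsTwoFourTransport.exists_forall_convCoeff_aeval_eq_zero_of_isAbsArithFrob W p κ
      (DiscreteGaloisModule.mu ℚ p) he' hnJ hJm Φ' Ψc hqp hur hΦ'I hΨI hr hloc h𝔓 hFr hρ hFrn hFrn'
  have hpow : ∀ x : Fin (2 * e' + 1 + 1) → WeierstrassCurve.geomTorsion W (p : ℤ),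
      (shiftEnd (WeierstrassCurve.geomTorsion W (p : ℤ)) (2 * e' + 1 + 1) ^ (e' + 1 + a)) x =
        (shiftEnd (WeierstrassCurve.geomTorsion W (p : ℤ)) (2 * e' + 1 + 1) ^ (e' + 1))
          ((shiftEnd (WeierstrassCurve.geomTorsion W (p : ℤ)) (2 * e' + 1 + 1) ^ a) x) := fun x => by
    rw [pow_add, Module.End.mul_apply]
  refine ⟨U', hU'0, fun i hi => ?_⟩
  have h := hU' i hi
  rw [hΦ'def, ZpExtension.shiftPowCocycle_apply] at h
  rw [hpow]
  exact h


end Summit.BirchSwinnertonDyer.BirchSwinnertonDyer.Rank1Residual.StepsTwoFour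

end
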